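import Summits.RiemannHypothesis.RiemannHypothesis.Theorems.JensenPolynomialsSkeletonExpansion

/-!
# Route `JensenPolynomials` — rung J-P (P1⁺), LEMMA R (algebraic core): the skeleton and all its lower-degree Appell
# polynomials in LAGUERRE FORM, and the critical points as images of the zeros of `L_{d−1}^{(n−½)}`

**RH-FREE, ξ-free** (an arbitrary real sequence `γ`; `b = n + ½`, `c = bκ_n`, `θ_n = 1 − κ_n`). This is the dictionary
the `K_m`-table of the blueprint (`skeletonSignTest_of_tables`, file `JensenPolynomialsSkeletonExpansion`) is read through:

* `eval_appellPoly_bessel`: for `b > 0`, `t ≠ 0`: `A^k_a(t) = t^k·(k!/(b)_k)·L_k^{(b−1)}(−c/t)`, `a_i = c^i/(b)_i`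
  (tree `jensenPoly_pochhammerInv` read in the Appell frame);
* `eval_appellPoly_skeletonSeq_laguerre`: for `e + θ_n ≠ 0`,
  `A^k_{s_n}(e) = (e+θ_n)^k·(k!/(b)_k)·L_k^{(n−½)}(τ)`, `τ = −bκ_n/(e+θ_n)`, for EVERY degree `k` — so at a point `e` the ratios
  the blueprint needs are `A^{d−m}_{s_n}(e)/A^{d}_{s_n}(e) = ((d−m)!·(b)_d/(d!·(b)_{d−m}))·(e+θ_n)^{−m}·L_{d−m}(τ)/L_d(τ)`
  (`appellPoly_skeletonSeq_ratio`), i.e. Laguerre value ratios at `τ`, which at a critical point are controlled by the tree's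
  `laguerre_interlacingRatio_abs_le` (LEMMA L1) and `laguerre_eval_succ_at_zero`;
* `add_skelTheta_ne_zero_of_derivative_eval_eq_zero`, `derivative_appellPoly_skeletonSeq_eval_eq_zero_iff`: for `κ_n > 0` and
  `d ≥ 1` the critical points `e` of the skeleton `A^d_{s_n}` are EXACTLY the points with `e + θ_n ≠ 0` and
  `L_{d−1}^{(n−½)}(−bκ_n/(e+θ_n)) = 0` — the DATA engines' `e_i = −θ − bκ/ℓ_i` (`ℓ_i` the zeros of `L_{d−1}^{(n−½)}`; eng-3 g2
  ET7 memo §1, skel.py) as a kernel statement.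

WHAT THIS IS NOT: no `K_m` table is derived here (that needs the oscillatory-window hypothesis of LEMMA L1 for the actual zeros,
Ismail–Li); no cell of the test is proved; nothing here bears on the truth of RH.
-/

noncomputable section
-- D-0017: `Summit.RiemannHypothesis.RiemannHypothesis.…` duplicates the namespace BY DESIGN (single-problem summit).
set_option linter.dupNamespace false

namespace Summit.RiemannHypothesis.RiemannHypothesis.Theorems.JensenPolynomials

open Literature.NumberTheory.LFunctions Polynomial Finset
open Literature.Analysis.SpecialFunctions (laguerre)
open scoped BigOperators Nat

/-! ## The Bessel Appell polynomials in Laguerre form -/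

/-- **Bessel Appell polynomial = reversed Laguerre polynomial**: for `b > 0`, any `c` and `t ≠ 0`,
`A^k_a(t) = t^k·(k!/(b)_k)·L_k^{(b−1)}(−c/t)` where `a_i = c^i/(b)_i`. -/
theorem eval_appellPoly_bessel {b : ℝ} (hb : 0 < b) (c : ℝ) (k : ℕ) {t : ℝ} (ht : t ≠ 0) :
    (appellPoly (fun i => c ^ i / (ascPochhammer ℝ i).eval b) k).eval t =
      t ^ k * ((k ! : ℝ) / (ascPochhammer ℝ k).eval b) * (laguerre (b - 1) k).eval (-c / t) := by
  rw [eval_appellPoly_eq_pow_mul_eval_jensenPoly _ k ht]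
  have hscale : (jensenPoly (fun i => c ^ i / (ascPochhammer ℝ i).eval b) k 0).eval t⁻¹ =
      (jensenPoly (fun i => 1 / (ascPochhammer ℝ i).eval b) k 0).eval (c * t⁻¹) := by
    rw [jensenPoly, jensenPoly, eval_finsetSum, eval_finsetSum]
    refine Finset.sum_congr rfl fun j _ => ?_
    simp only [eval_mul, eval_C, eval_pow, eval_X, zero_add, mul_pow]
    ring
  rw [hscale, jensenPoly_pochhammerInv hb 1 k 0]
  simp only [Nat.cast_zero, add_zero, eval_mul, eval_C, eval_comp, eval_neg, eval_X, one_mul, zero_add]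
  rw [show -(c * t⁻¹) = -c / t by ring]
  ring

/-- **The skeleton in Laguerre form, every degree**: for `e + θ_n ≠ 0`,
`A^k_{s_n}(e) = (e+θ_n)^k·(k!/(b)_k)·L_k^{(n−½)}(−bκ_n/(e+θ_n))`, `b = n + ½`. -/
theorem eval_appellPoly_skeletonSeq_laguerre (γ : ℕ → ℝ) (n k : ℕ) {e : ℝ} (he : e + skelTheta γ n ≠ 0) :
    (appellPoly (skeletonSeq γ n) k).eval e =
      (e + skelTheta γ n) ^ k * ((k ! : ℝ) / (ascPochhammer ℝ k).eval ((n : ℝ) + 1 / 2)) *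
        (laguerre ((n : ℝ) - 1 / 2) k).eval (-(((n : ℝ) + 1 / 2) * skelKappa γ n) / (e + skelTheta γ n)) := by
  have hb : (0 : ℝ) < (n : ℝ) + 1 / 2 := by positivity
  rw [appellPoly_skeletonSeq_eq_comp, eval_comp, eval_add, eval_X, eval_C, eval_appellPoly_bessel hb _ k he,
    show (n : ℝ) + 1 / 2 - 1 = (n : ℝ) - 1 / 2 by ring]

/-- **LEMMA R (ratio identity)**: at any point `e` with `e + θ_n ≠ 0` and any `m ≤ d`,
`A^{d−m}_{s_n}(e)·(e+θ_n)^m·(d!/(b)_d)·L_d(τ) = A^d_{s_n}(e)·((d−m)!/(b)_{d−m})·L_{d−m}(τ)`, `τ = −bκ_n/(e+θ_n)`: the ratio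
`A^{d−m}/A^{d}` the blueprint's `K_m` bounds is a Laguerre value ratio at `τ` times `(e+θ_n)^{−m}·(d−m)!(b)_d/(d!(b)_{d−m})`. -/
theorem appellPoly_skeletonSeq_ratio (γ : ℕ → ℝ) (n d m : ℕ) (hm : m ≤ d) {e : ℝ}
    (he : e + skelTheta γ n ≠ 0) :
    (appellPoly (skeletonSeq γ n) (d - m)).eval e * ((e + skelTheta γ n) ^ m *
        ((d ! : ℝ) / (ascPochhammer ℝ d).eval ((n : ℝ) + 1 / 2)) *
        (laguerre ((n : ℝ) - 1 / 2) d).eval (-(((n : ℝ) + 1 / 2) * skelKappa γ n) / (e + skelTheta γ n))) =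
      (appellPoly (skeletonSeq γ n) d).eval e * ((((d - m) ! : ℕ) : ℝ) /
        (ascPochhammer ℝ (d - m)).eval ((n : ℝ) + 1 / 2) *
        (laguerre ((n : ℝ) - 1 / 2) (d - m)).eval (-(((n : ℝ) + 1 / 2) * skelKappa γ n) / (e + skelTheta γ n))) := by
  rw [eval_appellPoly_skeletonSeq_laguerre γ n (d - m) he, eval_appellPoly_skeletonSeq_laguerre γ n d he,
    show (e + skelTheta γ n) ^ d = (e + skelTheta γ n) ^ (d - m) * (e + skelTheta γ n) ^ m by
      rw [← pow_add, Nat.sub_add_cancel hm]]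
  ring

/-! ## The critical points of the skeleton are the images of the Laguerre zeros -/

/-- At a critical point of the skeleton `A^d_{s_n}` (`d ≥ 1`, `κ_n > 0`), `e + θ_n ≠ 0`: otherwise `A^{d−1}_{s_n}(e) = A^{d−1}_a(0)
= a_{d−1} = (bκ_n)^{d−1}/(b)_{d−1} ≠ 0`. -/
theorem add_skelTheta_ne_zero_of_derivative_eval_eq_zero (γ : ℕ → ℝ) (n : ℕ) {d : ℕ} (hd : 1 ≤ d)
    (hκ : 0 < skelKappa γ n) {e : ℝ} (he : (derivative (appellPoly (skeletonSeq γ n) d)).eval e = 0) :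
    e + skelTheta γ n ≠ 0 := by
  intro h0
  rw [derivative_appellPoly_eval_eq_zero_iff _ hd, appellPoly_skeletonSeq_eq_comp, eval_comp, eval_add, eval_X,
    eval_C, h0, eval_zero_appellPoly] at he
  have hb : (0 : ℝ) < (n : ℝ) + 1 / 2 := by positivity
  have : 0 < (((n : ℝ) + 1 / 2) * skelKappa γ n) ^ (d - 1) / (ascPochhammer ℝ (d - 1)).eval ((n : ℝ) + 1 / 2) :=
    div_pos (pow_pos (mul_pos hb hκ) _) (ascPochhammer_pos _ _ hb)
  exact this.ne' he

/-- **Critical points ↔ Laguerre zeros** (`d ≥ 1`, `κ_n > 0`): `e` is a critical point of the skeleton `A^d_{s_n}` iff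
`e + θ_n ≠ 0` and `τ = −bκ_n/(e+θ_n)` is a zero of `L_{d−1}^{(n−½)}` — equivalently `e = −θ_n − bκ_n/τ` with `L_{d−1}^{(n−½)}(τ) = 0`
(the DATA engines' enumeration of the `d − 1` test points). -/
theorem derivative_appellPoly_skeletonSeq_eval_eq_zero_iff (γ : ℕ → ℝ) (n : ℕ) {d : ℕ} (hd : 1 ≤ d)
    (hκ : 0 < skelKappa γ n) (e : ℝ) :
    (derivative (appellPoly (skeletonSeq γ n) d)).eval e = 0 ↔
      e + skelTheta γ n ≠ 0 ∧
        (laguerre ((n : ℝ) - 1 / 2) (d - 1)).eval (-(((n : ℝ) + 1 / 2) * skelKappa γ n) / (e + skelTheta γ n)) = 0 := by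
  have hb : (0 : ℝ) < (n : ℝ) + 1 / 2 := by positivity
  constructor
  · intro he
    have hne := add_skelTheta_ne_zero_of_derivative_eval_eq_zero γ n hd hκ he
    refine ⟨hne, ?_⟩
    rw [derivative_appellPoly_eval_eq_zero_iff _ hd, eval_appellPoly_skeletonSeq_laguerre γ n (d - 1) hne] at he
    rcases mul_eq_zero.mp he with h | h
    · rcases mul_eq_zero.mp h with h' | h'
      · exact absurd h' (pow_ne_zero _ hne)
      · exact absurd h' (div_ne_zero (by positivity) (ascPochhammer_pos _ _ hb).ne')
    · exact h
  · rintro ⟨hne, hL⟩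
    rw [derivative_appellPoly_eval_eq_zero_iff _ hd, eval_appellPoly_skeletonSeq_laguerre γ n (d - 1) hne, hL, mul_zero]

/-- **The test points, explicitly**: for `κ_n > 0`, `d ≥ 1` and every zero `ℓ` of `L_{d−1}^{(n−½)}` (necessarily `ℓ > 0`, tree
`pos_of_isRoot_laguerre`), `e = −θ_n − bκ_n/ℓ` is a critical point of the skeleton `A^d_{s_n}`. -/
theorem derivative_appellPoly_skeletonSeq_eval_eq_zero_of_laguerre_root (γ : ℕ → ℝ) (n : ℕ) {d : ℕ} (hd : 1 ≤ d)
    (hκ : 0 < skelKappa γ n) {ℓ : ℝ} (hℓ : ℓ ≠ 0) (hroot : (laguerre ((n : ℝ) - 1 / 2) (d - 1)).eval ℓ = 0) :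
    (derivative (appellPoly (skeletonSeq γ n) d)).eval
      (-skelTheta γ n - ((n : ℝ) + 1 / 2) * skelKappa γ n / ℓ) = 0 := by
  have hb : (0 : ℝ) < (n : ℝ) + 1 / 2 := by positivity
  have hc : ((n : ℝ) + 1 / 2) * skelKappa γ n ≠ 0 := (mul_pos hb hκ).ne'
  have hne : -skelTheta γ n - ((n : ℝ) + 1 / 2) * skelKappa γ n / ℓ + skelTheta γ n ≠ 0 := by
    rw [show -skelTheta γ n - ((n : ℝ) + 1 / 2) * skelKappa γ n / ℓ + skelTheta γ n =
      -(((n : ℝ) + 1 / 2) * skelKappa γ n / ℓ) by ring]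
    exact neg_ne_zero.mpr (div_ne_zero hc hℓ)
  rw [derivative_appellPoly_skeletonSeq_eval_eq_zero_iff γ n hd hκ]
  refine ⟨hne, ?_⟩
  have h1 : -skelTheta γ n - ((n : ℝ) + 1 / 2) * skelKappa γ n / ℓ + skelTheta γ n =
      -(((n : ℝ) + 1 / 2) * skelKappa γ n / ℓ) := by ring
  rw [h1, neg_div_neg_eq, div_div_eq_mul_div, mul_div_cancel_left₀ ℓ hc]
  exact hroot

end Summit.RiemannHypothesis.RiemannHypothesis.Theorems.JensenPolynomials

end
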